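/-
Speedrun cell sr-mbsolver / programme hubbard-alg — LIT team (lit-1 gen-15), '→ lit-1' ask of lit-4 g11 (HOME/INBOX l.7462) for the FIRST
KSDN/LTI-FORMAT row of the programme (CERTIFIED #348, ref-1 R1.84; L3 eng-3 `ksdn-inst/1` + L4 `ksdn-cert/1`): lane-B / L3-D6 transport for
`relax = mps(N, D, A)` rows of the `jw-srot` form whose a-priori bounds are TRACE bounds. PRIMAL form, theorem-only.
HONEST FRAMING: first certified bounds; not a superconductivity verdict; every number certified or labelled float.

WHY. FORMAT-ksdn (L3-hybrid/eng-3/FORMAT-ksdn.md §1 `bounds`, §3 verdict): "B_m bounds Tr ω_m of the physical feasible point"; the two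
readers certify `E ≥ E_cert = β − Σ_m r_m · max_tag δ_(m,tag)`, i.e. a lower bound over the feasible set {FORMAT-ltisdp §4.7 rows, blocks
PSD, `Tr ω_m ≤ r_m`}. The tree's `jw-srot` node `Rows.MPSChainKSDNNodeSrot` (lit-1 gen-13) carries FORMAT-ltisdp §4.7's ENTRY bounds
`|ω_m[i,j]| ≤ B_m` only, so a ksdn certificate does not instantiate it. This file supplies the transport for the node WITH trace bounds
(`Rows/HubbardChainMPSTrNodesSrot.lean`, node `MPSChainKSDNTrNodeSrot`):

* `exists_mpsRowsTr_of_window` — KSDN's feasible point `ω_m = C_{m−2}(ρ|_{first m})` satisfies every `ω`-row of FORMAT-ltisdp §4.7 AND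
  the trace bounds `Re tr ω_m ≤ B_m` whenever `0 ≤ B_m`, `‖T^{m−2}‖_F² ≤ B_m²` (the proof of `exists_mpsRows_of_window`,
  `Transport/MPSPrimalWindow.lean`, verbatim, plus one conjunct from `MPSCoarseGraining.re_trace_cgState_le`:
  `Re tr C_k(ρ) ≤ ‖W_k W_kᴴ‖_F = ‖T^k‖_F`, `frobSq_cgMap_mul_conjTranspose`);
* `ksdnSrotClaim_of_mpsSrotTrClaim` — THEOREM B, `jw-srot` form, for the trace-bounded claim: the proof of
  `ksdnSrotClaim_of_mpsSrotClaim` (`Transport/MPSPrimalHubbardChainSrot.lean`) verbatim with the extra binder threaded.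

No model beyond `jw-srot`, no new definition, no `sorry`, no new axiom, no named fact.
[cite: KullEtAl2024, §2.3–2.5 eqs. (TNoneStepRelaxation), (TNfullRelax5); §4.2 eqs. (MPSextension), (relaxLocTIn); §6.2]
[cite: HornJohnson2013, Theorem 5.1.4, §5.6] [cite: ArakiMoriya2003, §4.1]
-/
import Summits.Ventures.CertifiedManyBodySolver.Transport.MPSPrimalHubbardChainSrot
import HarnessLib

noncomputable section

open Matrix Complex Filter Topology
open scoped ComplexOrder Kronecker BigOperators
open Literature.Probability.LatticeModels
open Literature.MathematicalPhysics.QuantumLattice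
open Literature.MathematicalPhysics.QuantumLattice.HubbardWave0
open Literature.MathematicalPhysics.QuantumLattice.ThermodynamicLimit
open Literature.MathematicalPhysics.QuantumLattice.JordanWigner
open Literature.MathematicalPhysics.QuantumManyBody.StateRelaxation
open Literature.MathematicalPhysics.QuantumLattice.MPSCoarseGraining
open Literature.Computability.QuantumComplexity (traceLeft traceRight)

namespace Summit.Ventures.CertifiedManyBodySolver.Transport

/-! ### KSDN's feasible point with the trace bounds `Re tr ω_m ≤ B_m` -/

section Window

variable {β G : Type*} [Fintype β] [DecidableEq β] [AddCommGroup G] {q : ℕ}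

/-- **KSDN's feasible point, model-independent core, WITH THE TRACE BOUNDS** (`exists_mpsRows_of_window` of
`Transport/MPSPrimalWindow.lean` verbatim plus one conjunct: `Re tr ω_m ≤ B_m`, `m = k+4 ≤ N`, from `re_trace_cgState_le`). (`N = m'+2 ≥ 4` sites). Given a real, charge-covariant MPS tensor `A`
with a-priori bounds `B_m` (`0 ≤ B_m`, `‖T^{m−2}‖_F² ≤ B_m²`) and a window variable `ρ ⪰ 0`, `tr ρ = 1`, `tr_L ρ = tr_R ρ`,
block diagonal in the total charge `Σ_x qs(·_x)`, entrywise real — there is a family `ω` such that, with `ρ₃ := ρ|_{first 3}`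
(`headMarginal`): E4L, E4R, E_mL / E_mR (`m = k+5 ≤ N`), `ω_m ⪰ 0`, `cgTag qs qb` sector zeros, real entries and `|ω_m| ≤ B_m`
(`m = k+4 ≤ N`) — the `ω`-rows of FORMAT-ltisdp §1/§4.7 with `W₂ = cgMap A 2`, `L = leftMap A`, `R = rightMap A`.
The witness is `ω_m = C_{m−2}(ρ|_{first m})` (`cgState`). [cite: KullEtAl2024, §2.3–2.5, §4.2 eqs. (MPSextension), (relaxLocTIn)] -/
theorem exists_mpsRowsTr_of_window (m' : ℕ) (hm' : 2 ≤ m') (A : Fin q → Matrix β β ℂ)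
    (hAreal : ∀ s a b, star (A s a b) = A s a b) (qs : Fin q → G) (qb : β → G)
    (hAcov : ∀ s a b, A s a b ≠ 0 → qb b = qb a + qs s)
    (B : ℕ → ℝ) (hB : ∀ k, k + 4 ≤ m' + 2 → 0 ≤ B (k + 4) ∧ frobSq (transferOp A ^ (k + 2)) ≤ B (k + 4) ^ 2)
    (ρ : Op (Fin (m' + 2)) q) (hpsd : ρ.PosSemidef) (htr : ρ.trace = 1)
    (hLTI : spinPartialTrace (Fin.succEmb (m' + 1)) ρ = spinPartialTrace Fin.castSuccEmb ρ)
    (hsec : ∀ u v : TensorIndex (Fin (m' + 2)) q, (∑ x, qs (u x)) ≠ (∑ x, qs (v x)) → ρ u v = 0)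
    (hstar : ∀ u v : TensorIndex (Fin (m' + 2)) q, star (ρ u v) = ρ u v) :
    ∃ ω : ℕ → Matrix (Fin q × ((β × β) × Fin q)) (Fin q × ((β × β) × Fin q)) ℂ,
      traceLeft (ω 4) = (cgMap A 2 ⊗ₖ (1 : Matrix (Fin q) (Fin q) ℂ)) *
          (headMarginal (show 3 ≤ m' + 2 by omega) ρ).submatrix
            ((Equiv.prodComm _ _).trans (Fin.snocEquiv fun _ => Fin q))
            ((Equiv.prodComm _ _).trans (Fin.snocEquiv fun _ => Fin q)) *
        (cgMap A 2 ⊗ₖ (1 : Matrix (Fin q) (Fin q) ℂ))ᴴ ∧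
      traceRight ((ω 4).submatrix (Equiv.prodAssoc _ _ _) (Equiv.prodAssoc _ _ _)) =
        ((1 : Matrix (Fin q) (Fin q) ℂ) ⊗ₖ cgMap A 2) *
          (headMarginal (show 3 ≤ m' + 2 by omega) ρ).submatrix (Fin.consEquiv fun _ => Fin q)
            (Fin.consEquiv fun _ => Fin q) *
        ((1 : Matrix (Fin q) (Fin q) ℂ) ⊗ₖ cgMap A 2)ᴴ ∧
      (∀ k, k + 5 ≤ m' + 2 → traceLeft (ω (k + 5)) =
        (leftMap A ⊗ₖ (1 : Matrix (Fin q) (Fin q) ℂ)) *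
          (ω (k + 4)).submatrix (Equiv.prodAssoc _ _ _) (Equiv.prodAssoc _ _ _) *
        (leftMap A ⊗ₖ (1 : Matrix (Fin q) (Fin q) ℂ))ᴴ) ∧
      (∀ k, k + 5 ≤ m' + 2 → traceRight ((ω (k + 5)).submatrix (Equiv.prodAssoc _ _ _) (Equiv.prodAssoc _ _ _)) =
        ((1 : Matrix (Fin q) (Fin q) ℂ) ⊗ₖ rightMap A) * ω (k + 4) *
        ((1 : Matrix (Fin q) (Fin q) ℂ) ⊗ₖ rightMap A)ᴴ) ∧
      (∀ k, k + 4 ≤ m' + 2 → (ω (k + 4)).PosSemidef) ∧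
      (∀ k, k + 4 ≤ m' + 2 → ∀ i j, cgTag qs qb i ≠ cgTag qs qb j → ω (k + 4) i j = 0) ∧
      (∀ k, k + 4 ≤ m' + 2 → ∀ i j, starRingEnd ℂ (ω (k + 4) i j) = ω (k + 4) i j) ∧
      (∀ k, k + 4 ≤ m' + 2 → ∀ i j, ‖ω (k + 4) i j‖ ≤ B (k + 4)) ∧
      (∀ k, k + 4 ≤ m' + 2 → ((ω (k + 4)).trace).re ≤ B (k + 4)) := by
  classical
  have h3 : 3 ≤ m' + 2 := by omega
  have h4 : 4 ≤ m' + 2 := by omega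
  -- head marginals: states, real, sectored
  have hHpsd : ∀ {m} (h : m ≤ m' + 2), (headMarginal h ρ).PosSemidef := fun h => posSemidef_headMarginal h hpsd
  have hHtr : ∀ {m} (h : m ≤ m' + 2), (headMarginal h ρ).trace = 1 := fun h => by rw [trace_headMarginal, htr]
  have hHstar : ∀ {m} (h : m ≤ m' + 2) (t s : TensorIndex (Fin m) q),
      star (headMarginal h ρ t s) = headMarginal h ρ t s := fun h t s => star_headMarginal_apply hstar h t s
  have hHsec : ∀ {m} (h : m ≤ m' + 2) (u v : TensorIndex (Fin m) q),
      (∑ x, qs (u x)) ≠ (∑ x, qs (v x)) → headMarginal h ρ u v = 0 := fun h u v huv =>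
    headMarginal_apply_eq_zero_of_charge qs h hsec huv
  -- the witness `ω_m = C_{m-2}(ρ|_m)` for `4 ≤ m ≤ m'+2`, zero elsewhere
  set ω : ℕ → Matrix (Fin q × ((β × β) × Fin q)) (Fin q × ((β × β) × Fin q)) ℂ :=
    fun m => if h : 4 ≤ m ∧ m ≤ m' + 2 then
      cgState A (m - 4 + 2) (headMarginal (show m - 4 + 2 + 2 ≤ m' + 2 by omega) ρ) else 0 with hωdef
  have hω4' : ω 4 = cgState A 2 (headMarginal h4 ρ) :=
    dif_pos (show 4 ≤ 4 ∧ 4 ≤ m' + 2 from ⟨le_rfl, h4⟩)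
  have hω4 : ∀ k (hk : k + 4 ≤ m' + 2), ω (k + 4) = cgState A (k + 2) (headMarginal hk ρ) := fun k hk =>
    dif_pos (show 4 ≤ k + 4 ∧ k + 4 ≤ m' + 2 from ⟨by omega, hk⟩)
  have hω5 : ∀ k (hk : k + 5 ≤ m' + 2), ω (k + 5) = cgState A (k + 3) (headMarginal hk ρ) := fun k hk =>
    dif_pos (show 4 ≤ k + 5 ∧ k + 5 ≤ m' + 2 from ⟨by omega, hk⟩)
  refine ⟨ω, ?_, ?_, ?_, ?_, ?_, ?_, ?_, ?_, ?_⟩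
  · -- E4L: `tr_L ρ₄ = ρ₃` by LTI
    have e2 : spinPartialTrace (Fin.succEmb 3) (headMarginal h4 ρ) = headMarginal h3 ρ :=
      spinPartialTrace_succEmb_headMarginal hLTI (show 3 ≤ m' + 1 by omega)
    calc traceLeft (ω 4) = traceLeft (cgState A 2 (headMarginal h4 ρ)) := by rw [hω4']
      _ = (cgMap A 2 ⊗ₖ (1 : Matrix (Fin q) (Fin q) ℂ)) *
            (spinPartialTrace (Fin.succEmb 3) (headMarginal h4 ρ)).submatrix
              ((Equiv.prodComm _ _).trans (Fin.snocEquiv fun _ => Fin q))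
              ((Equiv.prodComm _ _).trans (Fin.snocEquiv fun _ => Fin q)) *
          (cgMap A 2 ⊗ₖ (1 : Matrix (Fin q) (Fin q) ℂ))ᴴ := traceLeft_cgState A 2 _
      _ = _ := by rw [e2]
  · -- E4R: `tr_R ρ₄ = ρ₃`
    have e2 : spinPartialTrace Fin.castSuccEmb (headMarginal h4 ρ) = headMarginal h3 ρ :=
      spinPartialTrace_castSuccEmb_headMarginal h4 ρ
    calc traceRight ((ω 4).submatrix (Equiv.prodAssoc _ _ _) (Equiv.prodAssoc _ _ _))
        = traceRight ((cgState A 2 (headMarginal h4 ρ)).submatrix (Equiv.prodAssoc _ _ _) (Equiv.prodAssoc _ _ _)) := by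
          rw [hω4']
      _ = ((1 : Matrix (Fin q) (Fin q) ℂ) ⊗ₖ cgMap A 2) *
            (spinPartialTrace Fin.castSuccEmb (headMarginal h4 ρ)).submatrix (Fin.consEquiv fun _ => Fin q)
              (Fin.consEquiv fun _ => Fin q) *
          ((1 : Matrix (Fin q) (Fin q) ℂ) ⊗ₖ cgMap A 2)ᴴ := traceRight_cgState_submatrix_prodAssoc A 2 _
      _ = _ := by rw [e2]
  · -- E_mL
    intro k hk5
    have hk4 : k + 4 ≤ m' + 2 := by omega
    have hkM : k + 2 + 2 ≤ m' + 1 := by omega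
    rw [hω5 k hk5, hω4 k hk4]
    exact traceLeft_cgState_headMarginal A (k + 2) hLTI hkM
  · -- E_mR
    intro k hk5
    have hk4 : k + 4 ≤ m' + 2 := by omega
    have hkM : k + 2 + 2 ≤ m' + 1 := by omega
    rw [hω5 k hk5, hω4 k hk4]
    exact traceRight_cgState_headMarginal A (k + 2) ρ hkM
  · -- PSD
    intro k hk
    rw [hω4 k hk]
    exact posSemidef_cgState A (k + 2) (hHpsd hk)
  · -- sectors
    intro k hk i j hij
    rw [hω4 k hk]
    exact cgState_apply_eq_zero_of_cgTag_ne (qs := qs) hAcov (k + 2) (hHsec hk) i j hij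
  · -- real entries
    intro k hk i j
    rw [hω4 k hk, starRingEnd_apply]
    exact star_cgState_apply hAreal (k + 2) (hHstar hk) i j
  · -- a-priori bounds
    intro k hk i j
    rw [hω4 k hk]
    exact norm_cgState_apply_le_of_transferOp A (k + 2) (hHpsd hk) (hHtr hk) (hB k hk).1 (hB k hk).2 i j
  · -- trace bounds `Re tr ω_m ≤ ‖W_{m-2} W_{m-2}ᴴ‖_F = ‖T^{m-2}‖_F ≤ B_m`
    intro k hk
    rw [hω4 k hk]
    refine (re_trace_cgState_le A (k + 2) (hHpsd hk) (hHtr hk)).trans ?_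
    rw [frobSq_cgMap_mul_conjTranspose]
    exact (Real.sqrt_le_sqrt (hB k hk).2).trans_eq (Real.sqrt_sq (hB k hk).1)

end Window

/-! ### THEOREM B, `jw-srot` form, trace-bounded claim: the `mps(N, D, A)` statement implies the `jw-srot` window statement -/

section Transport

variable {β : Type*} [Fintype β] [DecidableEq β]

/-- **THEOREM B, `jw-srot` form, TRACE-BOUNDED claim (edge form): the primal `mps(N, D, A)` statement for `hubbard_jwsrot(U)` WITH
the per-level trace bounds `Re tr ω_m ≤ B_m` among its hypotheses (the `ksdn-inst/1` / `ksdn-cert/1` relaxation, FORMAT-ksdn §1 `bounds`: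
"B_m bounds Tr ω_m of the physical feasible point") implies the primal `jw-srot` `lti(N)` window statement.** Verbatim
`ksdnSrotClaim_of_mpsSrotClaim` with ONE extra binder in `hclaim` (after the entry bounds): `∀ k, k+4 ≤ N → Re tr ω_{k+4} ≤ B_{k+4}`;
the feasible point is `exists_mpsRowsTr_of_window`. Data: window `N = n+3 ≥ 4` sites; a REAL MPS tensor `A = (A^s)_{s ∈ Fin 4}` on the bond index
type `β`, CHARGE COVARIANT for `q_eff(s) = cb·|occ(s)| − ca` with bond charges `qb : β → ℤ` (FORMAT §4.11/§4.12 "CHECKED at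
generation"); a-priori bounds `B_m ≥ 0` with `‖T^{m−2}‖_F² ≤ B_m²`; the coordinates `e₃ : Fin 3 ≃ {-1,0,1}`, `i ↦ i − 1`. HYPOTHESIS
`hclaim` = the by-value node of a `hubbard_jwsrot` `mps` row: over `ρ₃ : Op (PolySite {-1,0,1}) 4` and `ω₄, …, ω_N` — `ρ₃ ⪰ 0`,
`tr ρ₃ = 1`, LTI `tr_{-1} ρ₃ = tr_{1} ρ₃`, TOTAL-OCCUPATION sector zeros, total density of site `-1` equal to `ν`, real entries, `|ρ₃| ≤ 1`;
E4L/E4R with `ρ₃` read through `e₃` then as (first two, last) / (first, last two); E_mL/E_mR (`m = k+5 ≤ N`); `ω_m ⪰ 0`,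
`cgTag q_eff qb` sectors, real, `|ω_m| ≤ B_m` (`m = k+4 ≤ N`); conclusion
`E ≤ Re tr(toSpin(U n_{-1↑}n_{-1↓} − t Σ_σ (c†_{-1σ} c_{0σ̄} + c†_{0σ̄} c_{-1σ})) ρ₃)`. CONCLUSION: the hypothesis `hclaim` of
`Transport.ksdnClaim_of_srotClaim` on `{-1, …, n+1}` with density `ν` (the `jw-srot` window statement).
[cite: KullEtAl2024, §2.3–2.5, §4.2, §6.2] [cite: ArakiMoriya2003, §4.1] -/
theorem ksdnSrotClaim_of_mpsSrotTrClaim (t U : ℝ) (n : ℕ) (hn : 1 ≤ n) (A : Fin 4 → Matrix β β ℂ)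
    (hAreal : ∀ s a b, star (A s a b) = A s a b) (qb : β → ℤ) (cb ca : ℤ)
    (hAcov : ∀ s a b, A s a b ≠ 0 → qb b = qb a + (fun s : Fin 4 => cb * ((siteOcc s).card : ℤ) - ca) s)
    (B : ℕ → ℝ) (hB : ∀ k, k + 4 ≤ n + 3 → 0 ≤ B (k + 4) ∧ frobSq (transferOp A ^ (k + 2)) ≤ B (k + 4) ^ 2)
    (e₃ : Fin 3 ≃ PolySite (chainWindow (-1) 1)) (he₃ : ∀ i, ofLex (e₃ i).1 0 = ((i : ℕ) : ℤ) - 1)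
    {ν E : ℝ}
    (hclaim : ∀ (ρ₃ : Op (PolySite (chainWindow (-1) 1)) 4)
        (ω : ℕ → Matrix (Fin 4 × ((β × β) × Fin 4)) (Fin 4 × ((β × β) × Fin 4)) ℂ),
      ρ₃.PosSemidef → ρ₃.trace = 1 →
      spinPartialTrace ((PolySite.affEmb 1 (unitVec 0) (chainWindow (-1) 0)).trans
          (PolySite.incl affShiftSet_chainWindow_zero_subset_one)) ρ₃ =
        spinPartialTrace (PolySite.incl chainWindow_zero_subset_one) ρ₃ →
      (∀ k k' : TensorIndex (PolySite (chainWindow (-1) 1)) 4,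
        (∑ x, (siteOcc (k x)).card) ≠ (∑ x, (siteOcc (k' x)).card) → ρ₃ k k' = 0) →
      ((toSpin (nAt (-unitVec 0) neg_unitVec_mem_chainWindow_one 0 +
          nAt (-unitVec 0) neg_unitVec_mem_chainWindow_one 1) * ρ₃).trace).re = ν →
      (∀ k k' : TensorIndex (PolySite (chainWindow (-1) 1)) 4, starRingEnd ℂ (ρ₃ k k') = ρ₃ k k') →
      (∀ k k' : TensorIndex (PolySite (chainWindow (-1) 1)) 4, ‖ρ₃ k k'‖ ≤ 1) →
      traceLeft (ω 4) = (cgMap A 2 ⊗ₖ (1 : Matrix (Fin 4) (Fin 4) ℂ)) *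
          (ρ₃.submatrix (Equiv.arrowCongr e₃ (Equiv.refl (Fin 4))) (Equiv.arrowCongr e₃ (Equiv.refl (Fin 4)))).submatrix
            ((Equiv.prodComm _ _).trans (Fin.snocEquiv fun _ => Fin 4))
            ((Equiv.prodComm _ _).trans (Fin.snocEquiv fun _ => Fin 4)) *
        (cgMap A 2 ⊗ₖ (1 : Matrix (Fin 4) (Fin 4) ℂ))ᴴ →
      traceRight ((ω 4).submatrix (Equiv.prodAssoc _ _ _) (Equiv.prodAssoc _ _ _)) =
        ((1 : Matrix (Fin 4) (Fin 4) ℂ) ⊗ₖ cgMap A 2) *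
          (ρ₃.submatrix (Equiv.arrowCongr e₃ (Equiv.refl (Fin 4))) (Equiv.arrowCongr e₃ (Equiv.refl (Fin 4)))).submatrix
            (Fin.consEquiv fun _ => Fin 4) (Fin.consEquiv fun _ => Fin 4) *
        ((1 : Matrix (Fin 4) (Fin 4) ℂ) ⊗ₖ cgMap A 2)ᴴ →
      (∀ k, k + 5 ≤ n + 3 → traceLeft (ω (k + 5)) =
        (leftMap A ⊗ₖ (1 : Matrix (Fin 4) (Fin 4) ℂ)) *
          (ω (k + 4)).submatrix (Equiv.prodAssoc _ _ _) (Equiv.prodAssoc _ _ _) *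
        (leftMap A ⊗ₖ (1 : Matrix (Fin 4) (Fin 4) ℂ))ᴴ) →
      (∀ k, k + 5 ≤ n + 3 → traceRight ((ω (k + 5)).submatrix (Equiv.prodAssoc _ _ _) (Equiv.prodAssoc _ _ _)) =
        ((1 : Matrix (Fin 4) (Fin 4) ℂ) ⊗ₖ rightMap A) * ω (k + 4) *
        ((1 : Matrix (Fin 4) (Fin 4) ℂ) ⊗ₖ rightMap A)ᴴ) →
      (∀ k, k + 4 ≤ n + 3 → (ω (k + 4)).PosSemidef) →
      (∀ k, k + 4 ≤ n + 3 → ∀ i j,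
        cgTag (fun s : Fin 4 => cb * ((siteOcc s).card : ℤ) - ca) qb i ≠
        cgTag (fun s : Fin 4 => cb * ((siteOcc s).card : ℤ) - ca) qb j → ω (k + 4) i j = 0) →
      (∀ k, k + 4 ≤ n + 3 → ∀ i j, starRingEnd ℂ (ω (k + 4) i j) = ω (k + 4) i j) →
      (∀ k, k + 4 ≤ n + 3 → ∀ i j, ‖ω (k + 4) i j‖ ≤ B (k + 4)) →
      (∀ k, k + 4 ≤ n + 3 → ((ω (k + 4)).trace).re ≤ B (k + 4)) →
      E ≤ ((toSpin ((U : ℂ) • (nAt (-unitVec 0) neg_unitVec_mem_chainWindow_one 0 *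
            nAt (-unitVec 0) neg_unitVec_mem_chainWindow_one 1) +
          (-(t : ℂ)) • ∑ σ : Fin 2,
            ((cAt (-unitVec 0) neg_unitVec_mem_chainWindow_one σ)ᴴ *
                cAt 0 zero_mem_chainWindow_one σ.rev +
              (cAt 0 zero_mem_chainWindow_one σ.rev)ᴴ *
                cAt (-unitVec 0) neg_unitVec_mem_chainWindow_one σ)) * ρ₃).trace).re) :
    ∀ ρ : Op (PolySite (chainWindow (-1) ((n : ℤ) + 1))) 4, ρ.PosSemidef → ρ.trace = 1 →
      spinPartialTrace ((PolySite.affEmb 1 (unitVec 0) (chainWindow (-1) (n : ℤ))).trans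
          (PolySite.incl (affShiftSet_chainWindow_subset (-1) (n : ℤ)))) ρ =
        spinPartialTrace (PolySite.incl (chainWindow_mono_right (-1) (by omega : (n : ℤ) ≤ n + 1))) ρ →
      (∀ k k' : TensorIndex (PolySite (chainWindow (-1) ((n : ℤ) + 1))) 4,
        (∑ x, (siteOcc (k x)).card) ≠ (∑ x, (siteOcc (k' x)).card) → ρ k k' = 0) →
      ((toSpin (nAt (-unitVec 0) (neg_unitVec_mem_chainWindow (by omega : (-1 : ℤ) ≤ n + 1)) 0 +
          nAt (-unitVec 0) (neg_unitVec_mem_chainWindow (by omega : (-1 : ℤ) ≤ n + 1)) 1) * ρ).trace).re = ν →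
      (∀ k k' : TensorIndex (PolySite (chainWindow (-1) ((n : ℤ) + 1))) 4, starRingEnd ℂ (ρ k k') = ρ k k') →
      (∀ k k' : TensorIndex (PolySite (chainWindow (-1) ((n : ℤ) + 1))) 4, ‖ρ k k'‖ ≤ 1) →
      E ≤ ((toSpin ((U : ℂ) • (nAt (-unitVec 0) (neg_unitVec_mem_chainWindow (by omega : (-1 : ℤ) ≤ n + 1)) 0 *
            nAt (-unitVec 0) (neg_unitVec_mem_chainWindow (by omega : (-1 : ℤ) ≤ n + 1)) 1) +
          (-(t : ℂ)) • ∑ σ : Fin 2,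
            ((cAt (-unitVec 0) (neg_unitVec_mem_chainWindow (by omega : (-1 : ℤ) ≤ n + 1)) σ)ᴴ *
                cAt 0 (zero_mem_chainWindow (by omega : (0 : ℤ) ≤ n + 1)) σ.rev +
              (cAt 0 (zero_mem_chainWindow (by omega : (0 : ℤ) ≤ n + 1)) σ.rev)ᴴ *
                cAt (-unitVec 0) (neg_unitVec_mem_chainWindow (by omega : (-1 : ℤ) ≤ n + 1)) σ)) * ρ).trace).re := by
  intro ρ hpsd htr hLTI hsec hdens hreal _hbd
  classical
  -- the windows `W₃ = {-1,0,1} ⊆ W = {-1,…,n+1}` and the shifts of the LTI embeddings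
  have hW3 : chainWindow (-1) 1 ⊆ chainWindow (-1) ((n : ℤ) + 1) := chainWindow_mono_right (-1) (by omega)
  have hlow3 : IsLowerSet (Set.range (PolySite.incl hW3)) := isLowerSet_range_incl_chainWindow hW3
  have hφ₀ := shift_incl (chainWindow_mono_right (-1) (by omega : (n : ℤ) ≤ n + 1))
  have hφ₁ : ∀ y, ofLex (((PolySite.affEmb 1 (unitVec 0) (chainWindow (-1) (n : ℤ))).trans
      (PolySite.incl (affShiftSet_chainWindow_subset (-1) (n : ℤ)))) y).1 0 = ofLex y.1 0 + 1 := fun y => by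
    rw [shift_affEmb_trans_incl, chain_unitVec_apply_zero]
  -- (i) coordinates and the relabelled window variable `ρ^F`
  obtain ⟨eN, heN⟩ := exists_finEquiv_chainWindow (n + 3) ((n : ℤ) + 1) (by push_cast; ring)
  obtain ⟨e', he'⟩ := exists_finEquiv_chainWindow (n + 2) (n : ℤ) (by push_cast; ring)
  set ρF : Op (Fin (n + 3)) 4 := spinPartialTrace eN.toEmbedding ρ with hρFdef
  have hFpsd : ρF.PosSemidef := posSemidef_spinPartialTrace _ hpsd
  have hFtr : ρF.trace = 1 := by rw [hρFdef, trace_spinPartialTrace, htr]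
  have hsucc : (Fin.succEmb (n + 2)).trans eN.toEmbedding =
      e'.toEmbedding.trans ((PolySite.affEmb 1 (unitVec 0) (chainWindow (-1) (n : ℤ))).trans
        (PolySite.incl (affShiftSet_chainWindow_subset (-1) (n : ℤ)))) := by
    refine embedding_eq_of_coord_eq fun i => ?_
    rw [Function.Embedding.trans_apply, Function.Embedding.trans_apply, Equiv.coe_toEmbedding, Equiv.coe_toEmbedding, heN,
      hφ₁, he', Fin.coe_succEmb, Fin.val_succ]
    push_cast
    ring
  have hcast : (Fin.castSuccEmb : Fin (n + 2) ↪ Fin (n + 3)).trans eN.toEmbedding =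
      e'.toEmbedding.trans (PolySite.incl (chainWindow_mono_right (-1) (by omega : (n : ℤ) ≤ n + 1))) := by
    refine embedding_eq_of_coord_eq fun i => ?_
    rw [Function.Embedding.trans_apply, Function.Embedding.trans_apply, Equiv.coe_toEmbedding, Equiv.coe_toEmbedding, heN,
      hφ₀, he', Fin.coe_castSuccEmb, Fin.val_castSucc, add_zero]
  have hFLTI : spinPartialTrace (Fin.succEmb (n + 2)) ρF = spinPartialTrace Fin.castSuccEmb ρF := by
    rw [hρFdef, ← spinPartialTrace_trans, ← spinPartialTrace_trans, hsucc, hcast, spinPartialTrace_trans e'.toEmbedding,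
      spinPartialTrace_trans e'.toEmbedding, hLTI]
  have hFsecN : ∀ k k' : TensorIndex (Fin (n + 3)) 4,
      (∑ x, (siteOcc (k x)).card) ≠ (∑ x, (siteOcc (k' x)).card) → ρF k k' = 0 :=
    fun k k' h => spinPartialTrace_apply_eq_zero_of_charge (fun s : Fin 4 => (siteOcc s).card) eN.toEmbedding hsec h
  have hFsec : ∀ u v : TensorIndex (Fin (n + 3)) 4,
      (∑ x, (fun s : Fin 4 => cb * ((siteOcc s).card : ℤ) - ca) (u x)) ≠
        (∑ x, (fun s : Fin 4 => cb * ((siteOcc s).card : ℤ) - ca) (v x)) → ρF u v = 0 :=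
    fun u v huv => apply_eq_zero_of_sum_srotCharge_ne cb ca hFsecN u v huv
  have hFstar : ∀ u v, star (ρF u v) = ρF u v := fun u v => by
    have := conj_spinPartialTrace_apply eN.toEmbedding hreal u v
    rwa [starRingEnd_apply] at this
  -- (ii) the model-independent core: KSDN's `ω_m = C_{m−2}(ρ^F|_{first m})`
  obtain ⟨ω, hE4L, hE4R, hEmL, hEmR, hωpsd, hωsec, hωreal, hωbd, hωtr⟩ :=
    exists_mpsRowsTr_of_window (n + 1) (by omega) A hAreal _ qb hAcov B hB ρF hFpsd hFtr hFLTI hFsec hFstar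
  -- (iii) the three-site marginal `ρ₃` and its rows
  set ρ₃ : Op (PolySite (chainWindow (-1) 1)) 4 := spinPartialTrace (PolySite.incl hW3) ρ with hρ₃def
  have h3psd : ρ₃.PosSemidef := posSemidef_spinPartialTrace _ hpsd
  have h3tr : ρ₃.trace = 1 := by rw [hρ₃def, trace_spinPartialTrace, htr]
  have h3LTI : spinPartialTrace ((PolySite.affEmb 1 (unitVec 0) (chainWindow (-1) 0)).trans
        (PolySite.incl affShiftSet_chainWindow_zero_subset_one)) ρ₃ =
      spinPartialTrace (PolySite.incl chainWindow_zero_subset_one) ρ₃ := by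
    rw [hρ₃def, ← spinPartialTrace_trans, ← spinPartialTrace_trans]
    refine spinPartialTrace_eq_of_shift hφ₀ hφ₁ hLTI 1 ?_ ?_
    · intro y
      rw [shift_trans (shift_affEmb_trans_incl (unitVec (0 : Fin 1)) affShiftSet_chainWindow_zero_subset_one)
        (shift_incl hW3), chain_unitVec_apply_zero]
      push_cast
      ring
    · intro y
      rw [shift_trans (shift_incl chainWindow_zero_subset_one) (shift_incl hW3), add_zero]
  have h3sec : ∀ k k' : TensorIndex (PolySite (chainWindow (-1) 1)) 4,
      (∑ x, (siteOcc (k x)).card) ≠ (∑ x, (siteOcc (k' x)).card) → ρ₃ k k' = 0 :=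
    fun k k' h => spinPartialTrace_apply_eq_zero_of_charge (fun s : Fin 4 => (siteOcc s).card) (PolySite.incl hW3) hsec h
  have h3dens : ((toSpin (nAt (-unitVec 0) neg_unitVec_mem_chainWindow_one 0 +
      nAt (-unitVec 0) neg_unitVec_mem_chainWindow_one 1) * ρ₃).trace).re = ν := by
    rw [hρ₃def, trace_toSpin_mul_spinPartialTrace_incl hW3 hlow3, fermionEmbed_add, fermionEmbed_incl_nAt,
      fermionEmbed_incl_nAt]
    exact hdens
  have h3real : ∀ k k' : TensorIndex (PolySite (chainWindow (-1) 1)) 4, starRingEnd ℂ (ρ₃ k k') = ρ₃ k k' :=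
    fun k k' => conj_spinPartialTrace_apply (PolySite.incl hW3) hreal k k'
  have h3bd : ∀ k k' : TensorIndex (PolySite (chainWindow (-1) 1)) 4, ‖ρ₃ k k'‖ ≤ 1 :=
    norm_apply_le_one_of_posSemidef h3psd h3tr
  -- `ρ^F|_{first 3}` is `ρ₃` read through `e₃`
  have hemb : (Fin.castLEEmb (show 3 ≤ n + 3 by omega)).trans eN.toEmbedding =
      e₃.toEmbedding.trans (PolySite.incl hW3) := by
    refine embedding_eq_of_coord_eq fun i => ?_
    rw [Function.Embedding.trans_apply, Function.Embedding.trans_apply, Equiv.coe_toEmbedding, Equiv.coe_toEmbedding, heN,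
      Fin.castLEEmb_apply, Fin.val_castLE]
    change _ = ofLex (e₃ i).1 0
    rw [he₃]
  have hlink : headMarginal (show 3 ≤ n + 1 + 2 by omega) ρF =
      ρ₃.submatrix (Equiv.arrowCongr e₃ (Equiv.refl (Fin 4))) (Equiv.arrowCongr e₃ (Equiv.refl (Fin 4))) := by
    rw [headMarginal, hρFdef, ← spinPartialTrace_trans, hemb, spinPartialTrace_trans, spinPartialTrace_equiv]
    ext u v
    rw [reindexOp_apply, Matrix.submatrix_apply]
    rfl
  rw [hlink] at hE4L hE4R
  -- (iv) apply the `mps` claim and move the objective back to the big window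
  have hE := hclaim ρ₃ ω h3psd h3tr h3LTI h3sec h3dens h3real h3bd hE4L hE4R hEmL hEmR hωpsd hωsec hωreal hωbd hωtr
  rw [hρ₃def, trace_toSpin_mul_spinPartialTrace_incl hW3 hlow3] at hE
  simp only [fermionEmbed_add, fermionEmbed_smul, fermionEmbed_sum, fermionEmbed_mul, fermionEmbed_conjTranspose,
    fermionEmbed_incl_nAt, fermionEmbed_incl_cAt] at hE
  exact hE

end Transport

end Summit.Ventures.CertifiedManyBodySolver.Transport
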